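import Literature.MathematicalPhysics.QuantumFieldTheory.Balaban1983to89.B13NodeTorusTermwise
import Literature.MathematicalPhysics.QuantumFieldTheory.Balaban1983to89.B13PrimitiveKernels216

/-!
# `Balaban1983to89.B13NodeTorusKernel216` — node N10 ([Balaban1988RG2Cluster] Lemmas 1–3, `Dag.B13_main`) on the two-scale torus with
# Lemma 3's kernel inputs read AT NODE O's (2.16)-LEVEL RECORD: the seven primitive-kernel letters of
# `B13NodeTorusTermwise.b13Leaf_twoTorus_primitives` replaced, per term (𝐃, P) and configuration, by the TWO NAMED records
# `B13PrimitiveKernels216.Localisation17a` (L17a) and `Differences216` (L16a)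

statement-level skeleton of published theorems with citation tags; proofs where landed; nothing here is a claim about the Yang–Mills mass gap

Track A, DAG node N10 (KNIT-BY-NAME seat `pub-ymgap-dag-p2` = n10-a, generation 5, 2026-08-26).  HONEST FRAMING: count-neutral kernel
bookkeeping on the papers' periodic carrier; NOT a node discharge (the B13 group is RESIDUAL at NODE 00 Stages 5–8); one finite four-torus;
Bałaban AS PRINTED with page locators; nothing continuum ∕ ℝ⁴ ∕ OS ∕ mass-gap ∕ Clay.

WHY THIS FILE.  In the knit of record (`B13NodeTorusTermwise`, p411918, §4) the «NODE A ∕ second-gap» content of N10 — the random-walk control of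
the non-symmetric operators of (2.14) ([Balaban1988RG2Cluster] p. 13 *"G̃₃(x) has the same properties as G̃₂"*, p. 16 (2.16)–(2.17), (2.21)
*"R₂, R₃ satisfy (2.16) also"*; [13] = [Balaban1985BackgroundPropagators] Thm 3.15 ff., k-uniformity = pub-balaban GAPS G-B13-05 (b)(c) +
G-B9-10) — enters as SEVEN letter families `hGb hΓ₀b hCs hC216` (uniform localisation of `G(σ)`, `Γ₀`, `A(σ)⁻¹`, `C` — L17a) and
`hdΓ hdC hdE` ((2.16)-type σ-difference bounds — L16a).  The tree meanwhile carries NODE O's interface ONE LEVEL UP, as NAMED RECORDS: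
`B13PrimitiveKernels216.Localisation17a` ∕ `Differences216` (whose fields ARE those seven letters verbatim) are the record TYPES that
`NodeOKernel216.AcrossOn216.nodeA_inputs` DELIVERS, per member and term (at that theorem's rate ∕ constant pattern; the reduced-rate and reduced-input
bookkeeping is `B13PrimitiveKernels216Reduced` ∕ `NodeOKernel216R`, not repeated here), from NODE O's (2.16)-level record `AcrossOn216` (walk format forgotten;
ideation cell `ym-nodeO-ideate` P3 N2), itself fed by `B13TermWalkDataOneTorus.ExistsUniformAcrossSmall` (row (D4) NODE O, statement (v)⁺) or by
the five entrywise letter families of `NodeOLetters`.  This file states N10's Lemma-3 kernel inputs IN THAT CURRENCY, so that the N10 ⟸ NODE O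
junction is BY NAME: `b13Leaf_twoTorus_kernel216` = `b13Leaf_twoTorus_primitives` with `(h17 : … Localisation17a …)` and
`(h16 : … Differences216 …)` per `Z`, `t ∈ terms L M₃ Z`, `φ ∈ sp2 Z` in place of the seven letter blocks — every other binder, the
constants and the conclusion `Lemma1Printed ∧ Lemma2Printed ∧ Lemma3Printed` UNCHANGED and in the same order; proof = the theorem of record fed
with the record projections (`.hG .hΓ₀ .hCs .hC216 ∣ .hdΓ .hdC .hdE`), as `B13PrimitiveKernels216.h226_torus_of_kernelBounds` does one term
down; the node `Dag.B13_main (leavesP w P)` at a world whose B13 group is this torus step follows by `B13NodeTorusTermwise.b13_main_of_leaf_twoTorus`.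
Also, one level lower and for the TS-3 family socket: `h226_torus_of_kernel216_of_lemma2` ((2.26) for ONE term from Lemma 2 of the record + the two
records = `B13Lemma3TorusBinders.h226_torus_of_primitives_of_lemma2` re-currencied) and `termwise226_of_kernel216` (`B13Lemma3TorusSocket.Termwise226`
for the (2.14)-display term map from the same per-term data — the per-member input `h226` of `B13NodeTorusFamily.b13Family_of_termwise` ∕
`B13NodeTorusFamilyLocated.b13Family_located`, now statable in NODE O's currency).

WHAT REMAINS BY ASSERTION after this file (unchanged in substance, sharper in name): per member of Bałaban's exhausting family and per term, the
records L17a ∕ L16a AT HIS KERNELS with constants admissible for the numerics below — i.e. NODE O's `AcrossOn216` ∕ `ExistsUniformAcrossSmall`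
at the objects of record (open OBJECT-level content of row (D4); [13] Thm 3.15 ff.); termwise domination (2.9)∕(2.14); the per-term analytic
inputs of Lemmas 1–2 ((1.24)∕(1.30), the (1.38) data); identifications of a NODE-00 pin; numbers (jointly witnessed: `B13ChainJointNonvacuity`,
`B13NodeTorusFamilyNonvacuity`).
-/

noncomputable section

namespace Literature.MathematicalPhysics.QuantumFieldTheory.Balaban1983to89.B13NodeTorusKernel216

open Metric
open Literature.MathematicalPhysics.QuantumFieldTheory.Balaban1983to89
open Literature.MathematicalPhysics.QuantumFieldTheory.Balaban1983to89.B16Absorption (pbox)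
open Literature.MathematicalPhysics.QuantumFieldTheory.Balaban1983to89.TreeLengthTorus
open Literature.MathematicalPhysics.QuantumFieldTheory.Balaban1983to89.TreeLengthTorusGeometry
open Literature.MathematicalPhysics.QuantumFieldTheory.Balaban1983to89.TreeLengthTorusTransfer
open Literature.MathematicalPhysics.QuantumFieldTheory.Balaban1983to89.B12TreeDecay (kappa₀ K₀)
open Literature.MathematicalPhysics.QuantumFieldTheory.Balaban1983to89.B13Lemma3TorusData
open Literature.MathematicalPhysics.QuantumFieldTheory.Balaban1983to89.B13Lemma3Torus (TwoTorusStep)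
open Literature.MathematicalPhysics.QuantumFieldTheory.Balaban1983to89.B13Lemma3TorusSocket
open Literature.MathematicalPhysics.QuantumFieldTheory.Balaban1983to89.B13PkScaling (Qop scaled)
open Literature.MathematicalPhysics.QuantumFieldTheory.Balaban1983to89.DagBinding
open Literature.MathematicalPhysics.QuantumFieldTheory.Balaban1983to89.B13Bound143 (invTau R12)
open Literature.MathematicalPhysics.QuantumFieldTheory.Balaban1983to89.B13Term214 (term214 SepHolOn core214 F214)
open Literature.MathematicalPhysics.QuantumFieldTheory.Balaban1983to89.B13Lemma3TorusTerms (terms weight Z0)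
open Literature.MathematicalPhysics.QuantumFieldTheory.Balaban1983to89.B5TorusCover (UT)
open Literature.MathematicalPhysics.QuantumFieldTheory.Balaban1983to89.B9Thm37GlueTorus (tdist1)
open Literature.MathematicalPhysics.QuantumFieldTheory.Balaban1983to89.B13PrimitiveKernels216 (Localisation17a Differences216)
open Literature.MathematicalPhysics.QuantumFieldTheory.Balaban1983to89.B13Lemma3TorusBinders (h226_torus_of_primitives_of_lemma2)
open Literature.MathematicalPhysics.QuantumFieldTheory.Balaban1983to89.B13NodeTorusTermwise

section OneTerm

variable {L N' : ℕ} [NeZero L] [NeZero N'] {M : ℕ}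
variable {ν : ℕ} {Nf : Fin ν → ℕ} [∀ i, NeZero (Nf i)]
variable {Λ : Type} [Fintype Λ] [DecidableEq Λ] {C₀ : Type} [Fintype C₀] [DecidableEq C₀]

open Matrix Finset

open Classical in
/-- **(2.26) FOR ONE TERM OF THE TORUS MODEL FROM LEMMA 2 OF THE RECORD AND NODE O's TWO NAMED (2.16)-LEVEL RECORDS**
([Balaban1988RG2Cluster] (2.14)–(2.26) pp. 15–17).  Exactly `B13Lemma3TorusBinders.h226_torus_of_primitives_of_lemma2` (p410704; same binders in
the same order, same constants, same conclusion `‖(2.14)-term‖ ≤ weight · e^{a₅|Z|}`) except that its seven primitive-kernel letters `hG hΓ₀ hCs hC216`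
(«L17a») and `hdΓ hdC hdE` («L16a») are replaced by the two NAMED records `h17 : Localisation17a c A G Γ₀ C locΛ locN κ K_G K_Γ K_Cs K₀′` and
`h16 : Differences216 c A G Γ₀ C locΛ locN κ θ_Γ θ_C θ_E` of `B13PrimitiveKernels216` (whose fields are those letters verbatim) — one term down this
is `B13PrimitiveKernels216.h226_torus_of_kernelBounds`; here the Lemma-2 binders stay DISCHARGED from (1.42)∕(1.43)∕(1.36)-for-V″ of the torus step as
in the theorem of record.  Proof: that theorem applied to the record projections. [cite: Balaban1988RG2Cluster, (2.14)–(2.26) pp.15–17, Lemma 2 p.11] -/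
theorem h226_torus_of_kernel216_of_lemma2 (c : B13.Consts) (hκ₁1 : 1 ≤ c.κ₁) (hα₆ : c.α₆ ≠ 0)
    -- Lemma 2 of the record at the torus step, and the numbers of (2.18)–(2.20)
    (W : TwoTorusStep 4 L N') (hrepr : B13.Repr142 W.toStepData) (h143 : B13.Bound143 W.toStepData c)
    (h136 : B13.Bound136 W.toStepData c W.Vpp) (hvolk : ∀ Y, W.volk Y = Y.1.card)
    (h12 : R12 c) (hC₃ : 0 ≤ c.C₃) (hE : 0 < c.E₀) (hε : 0 < c.ε₁) (hC₁ : 0 < c.C₁) (hα : 0 < c.α₄)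
    (hM : 1 ≤ c.M) (hκ₁ : 1 + 4 * Real.log 162 ≤ c.κ₁) (hδκ : 64 * Real.log 162 ≤ c.δ * c.κ)
    (Z : TDom 4 N') (t : Finset (TDom 4 (L * N')) × Finset (TBond 4 M (L * N')))
    (hpos : ∀ Y : TDom 4 (L * N'), 0 < invTau c ((tsys 4 (L * N')).dj Y))
    (hhalf : ∀ Y : TDom 4 (L * N'), invTau c ((tsys 4 (L * N')).dj Y) ≤ 1 / 2)
    {Uσ Uτ : Set ℂ} (hUσ : IsOpen Uσ) (hUτ : IsOpen Uτ) (hUexp : Metric.closedBall (0 : ℂ) (Real.exp c.κ₁) ⊆ Uσ)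
    (hUtau : ∀ Y : TDom 4 (L * N'), Metric.closedBall (0 : ℂ) ((invTau c ((tsys 4 (L * N')).dj Y))⁻¹) ⊆ Uτ)
    {r : ℝ} (hr : 0 < r) (hr' : r ≤ Real.exp c.κ₁ - 1)
    (hsubτ : ∀ s ∈ Set.uIcc (0 : ℝ) 1, Metric.closedBall (s : ℂ) r ⊆ Uτ)
    (lZ : List (TPt 4 N')) (hlZ : lZ.Nodup ∧ lZ.toFinset = Z.1 \ tclosure L N' (Z0 M t))
    (lD : List (TDom 4 (L * N'))) (hlD : lD.Nodup ∧ lD.toFinset = t.1)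
    (A : (TPt 4 N' → ℂ) → Matrix Λ Λ ℂ) (Γ : (TPt 4 N' → ℂ) → (Λ ⊕ C₀ → ℝ) → (Λ → ℂ))
    -- the (2.3) characteristic functions: χ_{Y₀} ∈ [0,1] supported on the small fields, χᶜ_P = Π indicators
    (χY₀ χcP : (Λ → ℝ) → ℝ) (hχ0 : ∀ B, 0 ≤ χY₀ B) (hχ1 : ∀ B, χY₀ B ≤ 1)
    (P : Finset Λ) (hPcard : P.card = t.2.card) {rP : ℝ} (hrP : 0 ≤ rP)
    (hχc : ∀ B, χcP B = ∏ b ∈ P, (if rP ≤ |B b| then (1 : ℝ) else 0))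
    (Dfam : Finset (TDom 4 (L * N'))) (V : TDom 4 (L * N') → (Λ → ℝ) → ℂ)
    -- the record's objects behind the term: bonds, cubes, the real field inside the configurations, the potentials
    (ι : Λ → W.Bond) (hι : Function.Injective ι) (cube : W.Bond → TPt 4 (L * N'))
    (hQsupp : ∀ (Y : TDom 4 (L * N')) φ b b', W.Q Y φ b b' ≠ 0 → cube b ∈ Y.1 ∧ cube b' ∈ Y.1)
    {m' : ℕ} (hfibc : ∀ a : TPt 4 (L * N'), (univ.filter fun j => cube (ι j) = a).card ≤ m')
    (emb : (Λ → ℝ) → W.Φ) (hBv : ∀ B b, W.Bv (emb B) (ι b) = (B b : ℂ))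
    (hBv0 : ∀ B b', b' ∉ Set.range ι → W.Bv (emb B) b' = 0)
    (hV : ∀ Y ∈ Dfam, ∀ B, emb B ∈ W.sp1 Y → V Y B = W.V Y (emb B))
    (hχsupp : ∀ B, χY₀ B ≠ 0 → ∀ Y ∈ Dfam, emb B ∈ W.sp1 Y)
    -- separate analyticity of the X-integral (as in the capstone)
    (hΨσ : ∀ τ : TDom 4 (L * N') → ℂ, (∀ j, τ j ∈ Uτ) →
      SepHolOn Uσ (fun σ => core214 A Γ (F214 t.2.card χY₀ χcP Dfam V) σ τ))
    (hΨτ : ∀ σ : TPt 4 N' → ℂ, (∀ j, σ j ∈ Uσ) →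
      SepHolOn Uτ (fun τ => core214 A Γ (F214 t.2.card χY₀ χcP Dfam V) σ τ))
    {C : Matrix Λ Λ ℝ} (hC : C.PosDef) (Γ₀ : Matrix Λ (Λ ⊕ C₀) ℝ)
    (hAs : ∀ σ : TPt 4 N' → ℂ, (∀ j, ‖σ j‖ ≤ Real.exp c.κ₁) → (A σ).IsSymm)
    (hA : ∀ σ : TPt 4 N' → ℂ, (∀ j, ‖σ j‖ ≤ Real.exp c.κ₁) → ((A σ).map Complex.re).PosDef)
    (G : (TPt 4 N' → ℂ) → Matrix Λ (Λ ⊕ C₀) ℂ)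
    (hlin : ∀ σ : TPt 4 N' → ℂ, (∀ j, ‖σ j‖ ≤ Real.exp c.κ₁) →
      ∀ X : Λ ⊕ C₀ → ℝ, Γ σ X = G σ *ᵥ fun j => (X j : ℂ))
    {γ₂ : ℝ} (hγ₂ : 0 ≤ γ₂)
    -- bonds located on the torus `UT Nf` (for the kernel letters)
    (locΛ : Λ → UT Nf) (locN : Λ ⊕ C₀ → UT Nf) {m : ℕ}
    (hfibΛ : ∀ x : UT Nf, (Finset.univ.filter fun i => locΛ i = x).card ≤ m)
    (hfibN : ∀ x : UT Nf, (Finset.univ.filter fun j => locN j = x).card ≤ m)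
    -- rates and constants
    {kap kap' kap'' θ θE θΓ θC KG KΓ KCs K₀' : ℝ} (hkap'' : 0 < kap'') (h1 : kap'' < kap') (h2 : kap' < kap)
    (hθE : 0 ≤ θE) (hθΓ : 0 ≤ θΓ) (hθC : 0 ≤ θC) (hKG : 0 ≤ KG) (hKΓ : 0 ≤ KΓ) (hKCs : 0 ≤ KCs) (hK₀ : 0 ≤ K₀')
    (hθEle : θE ≤ θ) (hθΓle : θΓ ≤ θ)
    (hθR1le : (m * (1 + 2 / (kap - kap')) ^ ν) * (m * (1 + 2 / (kap' - kap'')) ^ ν)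
      * (θΓ * KCs * KG + KΓ * θC * KG + KΓ * K₀' * θΓ) ≤ θ)
    -- NODE O's two NAMED (2.16)-level records for the term: L17a and L16a (`B13PrimitiveKernels216`)
    (h17 : Localisation17a c A G Γ₀ C locΛ locN kap KG KΓ KCs K₀')
    (h16 : Differences216 c A G Γ₀ C locΛ locN kap θΓ θC θE)
    (hsmallKθ : K₀' * (m * (1 + 2 / kap) ^ ν) * (θ * (m * (1 + 2 / kap'') ^ ν)) < 1)
    -- the (2.24)–(2.25) smallness, with `a₂₀ = m′·α₄·M⁻⁴(1 + 32/(κ₁−1))⁴`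
    {cE g : ℝ} (hc0 : 0 ≤ cE) (hc : ∀ k, hC.1.eigenvalues k ≤ cE)
    (hαc : (2 * (θ * (m * (1 + 2 / kap'') ^ ν)) +
      (γ₂ + m' * c.α₄ * (c.M ^ 4)⁻¹ * (1 + 32 / (c.κ₁ - 1)) ^ 4)) * cE ≤ 1 / 2) (hg : 0 ≤ g)
    (hΓq : ∀ X : Λ ⊕ C₀ → ℝ, (Γ₀ *ᵥ X) ⬝ᵥ (C *ᵥ (Γ₀ *ᵥ X)) ≤ g * (X ⬝ᵥ X))
    (hsmall : (2 * (θ * (m * (1 + 2 / kap'') ^ ν)) +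
      (γ₂ + m' * c.α₄ * (c.M ^ 4)⁻¹ * (1 + 32 / (c.κ₁ - 1)) ^ 4)) * (1 + 2 * cE * g) ≤ 1 / 2)
    -- constant matching, p. 17, with `w = K₀(64,8)·α₄·#(⋃𝐃)`
    {a a₅ : ℝ} (hPa : a ≤ γ₂ * rP ^ 2)
    (hvol : 2 * (K₀' * (m * (1 + 2 / kap) ^ ν) * (θ * (m * (1 + 2 / kap'') ^ ν))
              * (1 + (1 - K₀' * (m * (1 + 2 / kap) ^ ν) * (θ * (m * (1 + 2 / kap'') ^ ν)))⁻¹) / 2)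
          * (Fintype.card Λ : ℝ)
        + K₀ 64 8 * c.α₄ * (((Dfam.image Subtype.val).biUnion id).card : ℝ)
        + (2 * (θ * (m * (1 + 2 / kap'') ^ ν)) +
            (γ₂ + m' * c.α₄ * (c.M ^ 4)⁻¹ * (1 + 32 / (c.κ₁ - 1)) ^ 4)) * cE * (Fintype.card Λ : ℝ)
        + (2 * (θ * (m * (1 + 2 / kap'') ^ ν)) +
            (γ₂ + m' * c.α₄ * (c.M ^ 4)⁻¹ * (1 + 32 / (c.κ₁ - 1)) ^ 4)) * (1 + 2 * cE * g)
            * (Fintype.card (Λ ⊕ C₀) : ℝ)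
        ≤ a₅ * ((Z.1).card : ℝ)) :
    ‖term214 r lZ lD (core214 A Γ (F214 t.2.card χY₀ χcP Dfam V)) 0 0‖ ≤
      weight L M c Z a t * Real.exp (a₅ * ((Z.1).card : ℝ)) :=
  h226_torus_of_primitives_of_lemma2 c hκ₁1 hα₆ W hrepr h143 h136 hvolk h12 hC₃ hE hε hC₁ hα hM hκ₁ hδκ Z t hpos
    hhalf hUσ hUτ hUexp hUtau hr hr' hsubτ lZ hlZ lD hlD A Γ χY₀ χcP hχ0 hχ1 P hPcard hrP hχc Dfam V ι hι cube
    hQsupp hfibc emb hBv hBv0 hV hχsupp hΨσ hΨτ hC Γ₀ hAs hA G hlin hγ₂ locΛ locN hfibΛ hfibN hkap'' h1 h2 hθE hθΓ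
    hθC hKG hKΓ hKCs hK₀ hθEle hθΓle hθR1le h17.hG h17.hΓ₀ h17.hCs h17.hC216 h16.hdΓ h16.hdC h16.hdE hsmallKθ hc0 hc
    hαc hg hΓq hsmall hPa hvol

end OneTerm

section Kernel216

variable {L N' : ℕ} [NeZero L] [NeZero N']

open Matrix

open Classical in
/-- **(2.26) TERMWISE ON THE TWO-SCALE TORUS — `B13Lemma3TorusSocket.Termwise226` — FROM LEMMA 2 OF THE RECORD AND NODE O's TWO NAMED (2.16)-LEVEL
RECORDS PER TERM** ([Balaban1988RG2Cluster] (2.14)–(2.26) pp. 15–17): the `h226` step inside `B13NodeTorusTermwise.b13Leaf_twoTorus_primitives`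
(p411918 §4) ISOLATED as a theorem and re-currencied — for every `Z ∈ 𝐃_{k+1}`, `φ ∈ sp2 Z` and term `t = (𝐃, P) ∈ terms L M₃ Z` the (2.14)-display
`term214 r lZ lD (core214 (A φ) (Γ φ) (F214 |P| χ_{Y₀} χᶜ_P 𝐃 V)) 0 0` obeys (2.26) at |P|-rate `a` and volume rate `a₅`, given Lemma 2 of the record at
the torus step (`h2`), `volk = #`, R12, the signs and thresholds (κ₁ ≥ 1 + 4 log 162, δκ ≥ 64 log 162, C₃ ≥ 0, |τ(Y)|⁻¹ ∈ ]0, ½]), the per-term primitive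
objects exactly as in the theorem of record (index types, parameter lists, kernels, (2.3) characteristic functions, potentials agreeing with V_k through
the embedding of the real field, separate holomorphy, `C ≻ 0` with eigenvalue bound, `Γ₀`, bond locations with fibre bounds, rates, smallness, constant
matching) and, in place of the seven kernel letters, `h17 : Localisation17a …` and `h16 : Differences216 …` per term (`B13PrimitiveKernels216`).  This is
the per-member input `h226` of the TS-3 family socket (`B13NodeTorusFamily.b13Family_of_termwise`, `B13NodeTorusFamilyLocated.b13Family_located`) in
NODE O's currency.  Proof: `h226_torus_of_kernel216_of_lemma2` term by term. [cite: Balaban1988RG2Cluster, (2.14)–(2.26) pp.15–17] -/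
theorem termwise226_of_kernel216
    (Wt : TwoTorusStep 4 L N') (c : B13.Consts)
    -- Lemma 2 of the record at the torus step and the numbers of (2.18)–(2.20)
    (h2 : B13.Lemma2Printed Wt.toStepData c) (hvolk : ∀ Y, Wt.volk Y = Y.1.card)
    (h12 : R12 c) (hC₃ : 0 ≤ c.C₃) (hE : 0 < c.E₀) (hε : 0 < c.ε₁) (hC₁ : 0 < c.C₁) (hα : 0 < c.α₄) (hM : 1 ≤ c.M)
    (hκ₁1 : 1 ≤ c.κ₁) (hα₆ : c.α₆ ≠ 0) (hκ₁B : 1 + 4 * Real.log 162 ≤ c.κ₁) (hδκB : 64 * Real.log 162 ≤ c.δ * c.κ)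
    (hpos : ∀ Y : TDom 4 (L * N'), 0 < invTau c ((tsys 4 (L * N')).dj Y))
    (hhalf : ∀ Y : TDom 4 (L * N'), invTau c ((tsys 4 (L * N')).dj Y) ≤ 1 / 2)
    (M₃ : ℕ) [NeZero M₃] {a a₅ : ℝ}
    -- (3) the Cauchy radius and the parameter domains (p. 15)
    {Uσ Uτ : Set ℂ} (hUσ : IsOpen Uσ) (hUτ : IsOpen Uτ) (hUexp : Metric.closedBall (0 : ℂ) (Real.exp c.κ₁) ⊆ Uσ)
    (hUtau : ∀ Y : TDom 4 (L * N'), Metric.closedBall (0 : ℂ) ((invTau c ((tsys 4 (L * N')).dj Y))⁻¹) ⊆ Uτ)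
    {r : ℝ} (hr : 0 < r) (hr' : r ≤ Real.exp c.κ₁ - 1)
    (hsubτ : ∀ x ∈ Set.uIcc (0 : ℝ) 1, Metric.closedBall (x : ℂ) r ⊆ Uτ)
    -- (3) per term (𝐃, P) of every Z ∈ 𝐃_{k+1}: index types, parameter lists, kernels, characteristic functions, potentials
    (Λ C₀ : TDom 4 N' → Finset (TDom 4 (L * N')) × Finset (TBond 4 M₃ (L * N')) → Type)
    [∀ Z t, Fintype (Λ Z t)] [∀ Z t, DecidableEq (Λ Z t)] [∀ Z t, Fintype (C₀ Z t)] [∀ Z t, DecidableEq (C₀ Z t)]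
    (lZ : TDom 4 N' → Finset (TDom 4 (L * N')) × Finset (TBond 4 M₃ (L * N')) → List (TPt 4 N'))
    (hlZ : ∀ Z, ∀ t ∈ terms L M₃ Z, (lZ Z t).Nodup ∧ (lZ Z t).toFinset = Z.1 \ tclosure L N' (Z0 M₃ t))
    (lD : TDom 4 N' → Finset (TDom 4 (L * N')) × Finset (TBond 4 M₃ (L * N')) → List (TDom 4 (L * N')))
    (hlD : ∀ Z, ∀ t ∈ terms L M₃ Z, (lD Z t).Nodup ∧ (lD Z t).toFinset = t.1)
    (Am : (Z : TDom 4 N') → (t : Finset (TDom 4 (L * N')) × Finset (TBond 4 M₃ (L * N'))) → Wt.Φ →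
      (TPt 4 N' → ℂ) → Matrix (Λ Z t) (Λ Z t) ℂ)
    (Γm : (Z : TDom 4 N') → (t : Finset (TDom 4 (L * N')) × Finset (TBond 4 M₃ (L * N'))) → Wt.Φ →
      (TPt 4 N' → ℂ) → (Λ Z t ⊕ C₀ Z t → ℝ) → (Λ Z t → ℂ))
    (χY₀ χcP : (Z : TDom 4 N') → (t : Finset (TDom 4 (L * N')) × Finset (TBond 4 M₃ (L * N'))) → (Λ Z t → ℝ) → ℝ)
    (hχ0 : ∀ Z t B, 0 ≤ χY₀ Z t B) (hχ1 : ∀ Z t B, χY₀ Z t B ≤ 1)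
    (Pl : (Z : TDom 4 N') → (t : Finset (TDom 4 (L * N')) × Finset (TBond 4 M₃ (L * N'))) → Finset (Λ Z t))
    (hPcard : ∀ Z, ∀ t ∈ terms L M₃ Z, (Pl Z t).card = t.2.card) {rP : ℝ} (hrP : 0 ≤ rP)
    (hχc : ∀ Z t B, χcP Z t B = ∏ b ∈ Pl Z t, (if rP ≤ |B b| then (1 : ℝ) else 0))
    (Dfam : TDom 4 N' → Finset (TDom 4 (L * N')) × Finset (TBond 4 M₃ (L * N')) → Finset (TDom 4 (L * N')))
    (Vr : (Z : TDom 4 N') → (t : Finset (TDom 4 (L * N')) × Finset (TBond 4 M₃ (L * N'))) → Wt.Φ →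
      TDom 4 (L * N') → (Λ Z t → ℝ) → ℂ)
    -- (3) the record's objects behind the terms: bonds, cubes, the real field inside the configurations
    (ιb : (Z : TDom 4 N') → (t : Finset (TDom 4 (L * N')) × Finset (TBond 4 M₃ (L * N'))) → Λ Z t → Wt.Bond)
    (hι : ∀ Z t, Function.Injective (ιb Z t)) (cube : Wt.Bond → TPt 4 (L * N'))
    (hQsupp : ∀ (Y : TDom 4 (L * N')) φ b b', Wt.Q Y φ b b' ≠ 0 → cube b ∈ Y.1 ∧ cube b' ∈ Y.1)
    {m' : ℕ} (hfibc : ∀ Z t (x : TPt 4 (L * N')), (Finset.univ.filter fun j => cube (ιb Z t j) = x).card ≤ m')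
    (emb : (Z : TDom 4 N') → (t : Finset (TDom 4 (L * N')) × Finset (TBond 4 M₃ (L * N'))) → Wt.Φ →
      (Λ Z t → ℝ) → Wt.Φ)
    (hBv : ∀ Z t φ B b, Wt.Bv (emb Z t φ B) (ιb Z t b) = (B b : ℂ))
    (hBv0 : ∀ Z t φ B b', b' ∉ Set.range (ιb Z t) → Wt.Bv (emb Z t φ B) b' = 0)
    (hVr : ∀ Z, ∀ t ∈ terms L M₃ Z, ∀ φ ∈ Wt.sp2 Z, ∀ Y ∈ Dfam Z t, ∀ B,
      emb Z t φ B ∈ Wt.sp1 Y → Vr Z t φ Y B = Wt.V Y (emb Z t φ B))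
    (hχsupp : ∀ Z, ∀ t ∈ terms L M₃ Z, ∀ φ ∈ Wt.sp2 Z, ∀ B, χY₀ Z t B ≠ 0 → ∀ Y ∈ Dfam Z t,
      emb Z t φ B ∈ Wt.sp1 Y)
    -- (3) separate holomorphy of the X-integral in (σ, τ)
    (hΨσ : ∀ Z, ∀ t ∈ terms L M₃ Z, ∀ φ ∈ Wt.sp2 Z, ∀ τ : TDom 4 (L * N') → ℂ, (∀ j, τ j ∈ Uτ) →
      SepHolOn Uσ (fun σ => core214 (Am Z t φ) (Γm Z t φ)
        (F214 t.2.card (χY₀ Z t) (χcP Z t) (Dfam Z t) (Vr Z t φ)) σ τ))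
    (hΨτ : ∀ Z, ∀ t ∈ terms L M₃ Z, ∀ φ ∈ Wt.sp2 Z, ∀ σ : TPt 4 N' → ℂ, (∀ j, σ j ∈ Uσ) →
      SepHolOn Uτ (fun τ => core214 (Am Z t φ) (Γm Z t φ)
        (F214 t.2.card (χY₀ Z t) (χcP Z t) (Dfam Z t) (Vr Z t φ)) σ τ))
    -- (3) the reference covariance, Γ₀, the kernels of Γ(σ)
    (Cm : (Z : TDom 4 N') → (t : Finset (TDom 4 (L * N')) × Finset (TBond 4 M₃ (L * N'))) → Wt.Φ →
      Matrix (Λ Z t) (Λ Z t) ℝ)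
    (Γ₀m : (Z : TDom 4 N') → (t : Finset (TDom 4 (L * N')) × Finset (TBond 4 M₃ (L * N'))) → Wt.Φ →
      Matrix (Λ Z t) (Λ Z t ⊕ C₀ Z t) ℝ)
    (Gm : (Z : TDom 4 N') → (t : Finset (TDom 4 (L * N')) × Finset (TBond 4 M₃ (L * N'))) → Wt.Φ →
      (TPt 4 N' → ℂ) → Matrix (Λ Z t) (Λ Z t ⊕ C₀ Z t) ℂ)
    (hAs : ∀ Z, ∀ t ∈ terms L M₃ Z, ∀ φ ∈ Wt.sp2 Z, ∀ σ : TPt 4 N' → ℂ, (∀ j, ‖σ j‖ ≤ Real.exp c.κ₁) →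
      (Am Z t φ σ).IsSymm)
    (hA : ∀ Z, ∀ t ∈ terms L M₃ Z, ∀ φ ∈ Wt.sp2 Z, ∀ σ : TPt 4 N' → ℂ, (∀ j, ‖σ j‖ ≤ Real.exp c.κ₁) →
      ((Am Z t φ σ).map Complex.re).PosDef)
    (hlin : ∀ Z, ∀ t ∈ terms L M₃ Z, ∀ φ ∈ Wt.sp2 Z, ∀ σ : TPt 4 N' → ℂ, (∀ j, ‖σ j‖ ≤ Real.exp c.κ₁) →
      ∀ X : Λ Z t ⊕ C₀ Z t → ℝ, Γm Z t φ σ X = Gm Z t φ σ *ᵥ fun j => (X j : ℂ))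
    {γ₂ : ℝ} (hγ₂ : 0 ≤ γ₂)
    -- (3) the bonds located on a site torus (for the kernel letters)
    {ν : ℕ} {Nf : Fin ν → ℕ} [∀ i, NeZero (Nf i)]
    (locΛ : (Z : TDom 4 N') → (t : Finset (TDom 4 (L * N')) × Finset (TBond 4 M₃ (L * N'))) → Λ Z t → UT Nf)
    (locN : (Z : TDom 4 N') → (t : Finset (TDom 4 (L * N')) × Finset (TBond 4 M₃ (L * N'))) →
      Λ Z t ⊕ C₀ Z t → UT Nf) {m : ℕ}
    (hfibΛ : ∀ Z t (x : UT Nf), (Finset.univ.filter fun i => locΛ Z t i = x).card ≤ m)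
    (hfibN : ∀ Z t (x : UT Nf), (Finset.univ.filter fun j => locN Z t j = x).card ≤ m)
    -- (3) rates and constants
    {kap kap' kap'' ϑ θE θΓ θC KG KΓ KCs K₀' : ℝ} (hkap'' : 0 < kap'') (hk1 : kap'' < kap') (hk2 : kap' < kap)
    (hθE : 0 ≤ θE) (hθΓ : 0 ≤ θΓ) (hθC : 0 ≤ θC) (hKG : 0 ≤ KG) (hKΓ : 0 ≤ KΓ) (hKCs : 0 ≤ KCs) (hK₀' : 0 ≤ K₀')
    (hθEle : θE ≤ ϑ) (hθΓle : θΓ ≤ ϑ)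
    (hθR1le : (m * (1 + 2 / (kap - kap')) ^ ν) * (m * (1 + 2 / (kap' - kap'')) ^ ν)
      * (θΓ * KCs * KG + KΓ * θC * KG + KΓ * K₀' * θΓ) ≤ ϑ)
    -- (3) NODE O's two NAMED (2.16)-level records per term and configuration: L17a and L16a
    (h17 : ∀ Z, ∀ t ∈ terms L M₃ Z, ∀ φ ∈ Wt.sp2 Z,
      Localisation17a c (Am Z t φ) (Gm Z t φ) (Γ₀m Z t φ) (Cm Z t φ) (locΛ Z t) (locN Z t) kap KG KΓ KCs K₀')
    (h16 : ∀ Z, ∀ t ∈ terms L M₃ Z, ∀ φ ∈ Wt.sp2 Z,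
      Differences216 c (Am Z t φ) (Gm Z t φ) (Γ₀m Z t φ) (Cm Z t φ) (locΛ Z t) (locN Z t) kap θΓ θC θE)
    (hsmallKθ : K₀' * (m * (1 + 2 / kap) ^ ν) * (ϑ * (m * (1 + 2 / kap'') ^ ν)) < 1)
    -- (3) the (2.24)–(2.25) smallness with `a₂₀ = m′·α₄·M⁻⁴(1 + 32/(κ₁−1))⁴`, norms of C and Γ₀
    {cE gq : ℝ} (hc0 : 0 ≤ cE)
    (hCq : ∀ Z, ∀ t ∈ terms L M₃ Z, ∀ φ ∈ Wt.sp2 Z, ∃ hC : (Cm Z t φ).PosDef, ∀ i, hC.1.eigenvalues i ≤ cE)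
    (hαc : (2 * (ϑ * (m * (1 + 2 / kap'') ^ ν)) +
      (γ₂ + m' * c.α₄ * (c.M ^ 4)⁻¹ * (1 + 32 / (c.κ₁ - 1)) ^ 4)) * cE ≤ 1 / 2) (hgq : 0 ≤ gq)
    (hΓq : ∀ Z, ∀ t ∈ terms L M₃ Z, ∀ φ ∈ Wt.sp2 Z, ∀ X : Λ Z t ⊕ C₀ Z t → ℝ,
      (Γ₀m Z t φ *ᵥ X) ⬝ᵥ (Cm Z t φ *ᵥ (Γ₀m Z t φ *ᵥ X)) ≤ gq * (X ⬝ᵥ X))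
    (hsmall : (2 * (ϑ * (m * (1 + 2 / kap'') ^ ν)) +
      (γ₂ + m' * c.α₄ * (c.M ^ 4)⁻¹ * (1 + 32 / (c.κ₁ - 1)) ^ 4)) * (1 + 2 * cE * gq) ≤ 1 / 2)
    -- (3) constant matching, p. 17: `a ≤ γ₂ r_P²` and the volume factor with `w = K₀(64,8)·α₄·#(⋃𝐃)`
    (hPa : a ≤ γ₂ * rP ^ 2)
    (hvol : ∀ Z, ∀ t ∈ terms L M₃ Z,
      2 * (K₀' * (m * (1 + 2 / kap) ^ ν) * (ϑ * (m * (1 + 2 / kap'') ^ ν))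
              * (1 + (1 - K₀' * (m * (1 + 2 / kap) ^ ν) * (ϑ * (m * (1 + 2 / kap'') ^ ν)))⁻¹) / 2)
          * (Fintype.card (Λ Z t) : ℝ)
        + K₀ 64 8 * c.α₄ * ((((Dfam Z t).image Subtype.val).biUnion id).card : ℝ)
        + (2 * (ϑ * (m * (1 + 2 / kap'') ^ ν)) +
            (γ₂ + m' * c.α₄ * (c.M ^ 4)⁻¹ * (1 + 32 / (c.κ₁ - 1)) ^ 4)) * cE * (Fintype.card (Λ Z t) : ℝ)
        + (2 * (ϑ * (m * (1 + 2 / kap'') ^ ν)) +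
            (γ₂ + m' * c.α₄ * (c.M ^ 4)⁻¹ * (1 + 32 / (c.κ₁ - 1)) ^ 4)) * (1 + 2 * cE * gq)
            * (Fintype.card (Λ Z t ⊕ C₀ Z t) : ℝ)
        ≤ a₅ * ((Z.1).card : ℝ))
    :
    Termwise226 c a a₅ Wt (fun Z t φ => term214 r (lZ Z t) (lD Z t)
      (core214 (Am Z t φ) (Γm Z t φ) (F214 t.2.card (χY₀ Z t) (χcP Z t) (Dfam Z t) (Vr Z t φ))) 0 0) := by
  intro Z φ hφ t ht
  obtain ⟨hCpd, hcE⟩ := hCq Z t ht φ hφ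
  exact h226_torus_of_kernel216_of_lemma2 c hκ₁1 hα₆ Wt h2.2.1 h2.2.2.1 h2.2.2.2.1 hvolk h12 hC₃ hE hε hC₁ hα hM hκ₁B
    hδκB Z t hpos hhalf hUσ hUτ hUexp hUtau hr hr' hsubτ (lZ Z t) (hlZ Z t ht) (lD Z t) (hlD Z t ht) (Am Z t φ) (Γm Z t φ)
    (χY₀ Z t) (χcP Z t) (hχ0 Z t) (hχ1 Z t) (Pl Z t) (hPcard Z t ht) hrP (hχc Z t) (Dfam Z t) (Vr Z t φ) (ιb Z t)
    (hι Z t) cube hQsupp (hfibc Z t) (emb Z t φ) (hBv Z t φ) (hBv0 Z t φ) (hVr Z t ht φ hφ) (hχsupp Z t ht φ hφ)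
    (hΨσ Z t ht φ hφ) (hΨτ Z t ht φ hφ) hCpd (Γ₀m Z t φ) (hAs Z t ht φ hφ) (hA Z t ht φ hφ) (Gm Z t φ)
    (hlin Z t ht φ hφ) hγ₂ (locΛ Z t) (locN Z t) (hfibΛ Z t) (hfibN Z t) hkap'' hk1 hk2 hθE hθΓ hθC hKG hKΓ hKCs hK₀'
    hθEle hθΓle hθR1le (h17 Z t ht φ hφ) (h16 Z t ht φ hφ) hsmallKθ hc0 hcE hαc hgq (hΓq Z t ht φ hφ) hsmall hPa
    (hvol Z t ht)

open Classical in
/-- **THE B13 LEAF TRIPLE ON THE TWO-SCALE TORUS WITH LEMMA 3's KERNEL INPUTS AT NODE O's (2.16)-LEVEL RECORD**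
([Balaban1988RG2Cluster] Lemma 1 p. 9, Lemma 2 p. 11, Lemma 3 (2.38) p. 20 via (2.14)–(2.26) pp. 15–17).  Exactly
`B13NodeTorusTermwise.b13Leaf_twoTorus_primitives` (p411918) — same binders in the same order, same constants, same conclusion — except that
the seven primitive-kernel letter families `hGb hΓ₀b hCs hC216` (uniform localisation of `G(σ)`, `Γ₀`, `A(σ)⁻¹`, `C` in the torus distance,
«L17a», [13] Thm 3.15 ff.) and `hdΓ hdC hdE` (the (2.16)-type bounds of the σ-differences, «L16a») are replaced, per term `t = (𝐃, P) ∈ terms L M₃ Z`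
of every `Z ∈ 𝐃_{k+1}` and every configuration `φ ∈ sp2 Z`, by the two NAMED records `h17 : Localisation17a c (A(σ)) (G(σ)) Γ₀ C locΛ locN κ K_G K_Γ
K_Cs K₀′` and `h16 : Differences216 c (A(σ)) (G(σ)) Γ₀ C locΛ locN κ θ_Γ θ_C θ_E` of `B13PrimitiveKernels216` — the record types in which
`NodeOKernel216.AcrossOn216.nodeA_inputs` delivers NODE O's walk package (rates ∕ constants as there; reduced forms: `B13PrimitiveKernels216Reduced`).
Proof: the theorem of record applied to the record projections `.hG .hΓ₀ .hCs .hC216 ∣ .hdΓ .hdC .hdE`.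
What remains by assertion: the two records at Bałaban's kernels (NODE O ∕ row (D4)), termwise domination, the per-term analytic inputs of
Lemmas 1–2, identifications, numbers. [cite: Balaban1988RG2Cluster, Lemmas 1–3 pp.9, 11, 20; (2.14)–(2.26) pp.15–17] -/
theorem b13Leaf_twoTorus_kernel216
    (Wt : TwoTorusStep 4 L N') (c : B13.Consts) (k : ℕ) (hN12 : 12 ≤ L * N') (hL8 : 8 ≤ c.L) (hLc : c.L = L)
    -- (1) LEMMA 1: index data of (1.33)
    (S0 : TDom 4 (L * N') → Finset (TPt 4 (L * N')))
    (F : TDom 4 (L * N') → TPt 4 (L * N') → Finset (TPt 4 (L * N')))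
    (Sq : TDom 4 (L * N') → TPt 4 (L * N') → (j : ℕ) → Finset (TPt 4 (L ^ (k - j) * (L * N'))))
    (SX : TDom 4 (L * N') → TPt 4 (L * N') → (j : ℕ) → TPt 4 (L ^ (k - j) * (L * N')) →
      Finset (TDom 4 (L ^ (k - j) * (L * N'))))
    (T : TDom 4 (L * N') → TPt 4 (L * N') → Finset (TPt 4 (L * N')) → (j : ℕ) →
      TPt 4 (L ^ (k - j) * (L * N')) → TDom 4 (L ^ (k - j) * (L * N')) → Wt.Φ → ℂ)
    (Sc : TDom 4 (L * N') → Finset (TPt 4 (L * N')))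
    (Sq' : TDom 4 (L * N') → TPt 4 (L * N') → (j : ℕ) → Finset (TPt 4 (L ^ (k - j) * (L * N'))))
    (SX' : TDom 4 (L * N') → TPt 4 (L * N') → (j : ℕ) → TPt 4 (L ^ (k - j) * (L * N')) →
      Finset (TDom 4 (L ^ (k - j) * (L * N'))))
    (T' : TDom 4 (L * N') → TPt 4 (L * N') → (j : ℕ) → TPt 4 (L ^ (k - j) * (L * N')) →
      TDom 4 (L ^ (k - j) * (L * N')) → Wt.Φ → ℂ)
    (dist : TDom 4 (L * N') → TPt 4 (L * N') → (j : ℕ) → TPt 4 (L ^ (k - j) * (L * N')) → ℝ) {K K' : ℝ}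
    (h133 : ∀ Y, Wt.Vp Y =
      (∑ a ∈ S0 Y, ∑ X ∈ (F Y a).powerset, ∑ j ∈ Finset.range (k + 1), ∑ q ∈ Sq Y a j,
        ∑ x ∈ SX Y a j q, T Y a X j q x) +
      (∑ a ∈ Sc Y, ∑ j ∈ Finset.range (k + 1), ∑ q ∈ Sq' Y a j, ∑ x ∈ SX' Y a j q, T' Y a j q x))
    (hS0Y : ∀ Y, ∀ a ∈ S0 Y,
      (pbox (fun i => natLift a i - (5 : ℕ)) (fun i => natLift a i + 1 + (5 : ℕ))).image (proj (L * N')) ⊆ Y.1)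
    (hFsub : ∀ Y a, F Y a ⊆
      (pbox (fun i => natLift a i - (5 : ℕ)) (fun i => natLift a i + 1 + (5 : ℕ))).image (proj (L * N')) \
        (pbox (fun i => natLift a i - (4 : ℕ)) (fun i => natLift a i + 1 + (4 : ℕ))).image (proj (L * N')))
    (hSq : ∀ Y, ∀ a ∈ S0 Y, ∀ j, Sq Y a j ⊆ (Finset.univ : Finset (TPt 4 (L ^ (k - j) * (L * N')))).filter
      (fun q => tcoarse (L ^ (k - j)) (L * N') q ∈
        (pbox (fun i => natLift a i - (2 : ℕ)) (fun i => natLift a i + 1 + (2 : ℕ))).image (proj (L * N'))))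
    (hScY : ∀ Y, Sc Y ⊆ Y.1)
    (hdist0 : ∀ Y a j q, 0 ≤ c.δ₀ * dist Y a j q)
    (hdist : ∀ Y a j (n : ℕ) q, q ∉ (pbox (fun i => ((L ^ (k - j) : ℕ) : ℤ) * natLift a i - (n + 1 : ℕ))
      (fun i => ((L ^ (k - j) : ℕ) : ℤ) * natLift a i + 2 * ((L ^ (k - j) : ℕ) : ℤ) - 1 + (n + 1 : ℕ))).image
        (proj (L ^ (k - j) * (L * N'))) → c.δ₀ * c.M * ((n : ℝ) + 1) ≤ c.δ₀ * dist Y a j q)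
    (hSX : ∀ Y a j q, SX Y a j q ⊆ (tcubeSys 4 (L ^ (k - j) * (L * N'))).above q)
    (hSX' : ∀ Y a j q, SX' Y a j q ⊆ (tcubeSys 4 (L ^ (k - j) * (L * N'))).above q)
    (hX0 : ∀ Y, ∀ a ∈ Sc Y, ∀ j ∈ Finset.range (k + 1), ∀ q ∈ Sq' Y a j, ∀ x ∈ SX' Y a j q,
      x.1.image (tcoarse (L ^ (k - j)) (L * N')) ⊆ Y.1)
    -- (1) LEMMA 1: analyticity of the terms, closure of `Analytic`
    (hAdd : ∀ (s : Set Wt.Φ) (f g : Wt.Φ → ℂ), Wt.Analytic f s → Wt.Analytic g s → Wt.Analytic (f + g) s)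
    (hZero : ∀ s : Set Wt.Φ, Wt.Analytic 0 s)
    (hAnT : ∀ Y, ∀ a ∈ S0 Y, ∀ X ∈ (F Y a).powerset, ∀ j ∈ Finset.range (k + 1), ∀ q ∈ Sq Y a j,
      ∀ x ∈ SX Y a j q, Wt.Analytic (T Y a X j q x) (Wt.sp1 Y))
    (hAnT' : ∀ Y, ∀ a ∈ Sc Y, ∀ j ∈ Finset.range (k + 1), ∀ q ∈ Sq' Y a j, ∀ x ∈ SX' Y a j q,
      Wt.Analytic (T' Y a j q x) (Wt.sp1 Y))
    -- (1) LEMMA 1: thresholds and restrictions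
    (hK : 0 ≤ K) (hK' : 0 ≤ K') (hκ : 0 ≤ c.κ) (hδ1 : c.δ < 1) (hδκ : 1 ≤ c.δ * c.κ)
    (hκ126 : kappa₀ 64 8 ≤ c.κ) (hκ126' : kappa₀ 64 8 ≤ c.δ * c.κ)
    (hκ₁ : 1 + 2 * Real.log (8 * 12 ^ 3) ≤ c.κ₁) (hκ₁' : 2 + 16 * Real.log 128 ≤ c.κ₁)
    (hδ₀M : 10 * Real.exp (-1) ≤ c.δ₀ * c.M) (hδ₀M5 : 2 * Real.log 5 ≤ c.δ₀ * c.M)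
    (hR8 : (1 - c.δ) * c.κ ≤ (1 / 4) * (c.κ₁ - 1)) (hR9 : (1 - 2 * c.δ) * c.κ ≤ (1 / 16) * c.κ₁)
    -- (1) LEMMA 1: per-term (1.24), (1.30); the constants of (1.36) with headroom (1 − θ) for the local pieces
    (h124 : ∀ Y φ, φ ∈ Wt.sp1 Y → ∀ a ∈ S0 Y, ∀ X ∈ (F Y a).powerset, ∀ j ∈ Finset.range (k + 1), ∀ q ∈ Sq Y a j,
      ∀ x ∈ SX Y a j q,
        ‖T Y a X j q x φ‖ ≤ K * ((L : ℝ) ^ j * ((L : ℝ) ^ k)⁻¹) ^ 5 *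
          Real.exp (-(c.κ₁ - 1) *
            (((Y.1 \ (pbox (fun i => natLift a i - (5 : ℕ)) (fun i => natLift a i + 1 + (5 : ℕ))).image
              (proj (L * N'))).card : ℝ) + X.card)) *
          Real.exp (-(c.κ * torusTreeLen x.1)))
    (h130 : ∀ Y φ, φ ∈ Wt.sp1 Y → ∀ a ∈ Sc Y, ∀ j ∈ Finset.range (k + 1), ∀ q ∈ Sq' Y a j,
      ∀ x ∈ SX' Y a j q,
        ‖T' Y a j q x φ‖ ≤ K' * Real.exp (-(1 / 2) * (c.δ₀ * c.M) * ((L : ℝ) ^ j * ((L : ℝ) ^ k)⁻¹)⁻¹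
            - (1 / 2) * c.δ₀ * dist Y a j q) *
          Real.exp (-(c.κ₁ - 1) * ((Y.1 \ x.1.image (tcoarse (L ^ (k - j)) (L * N'))).card : ℝ)) *
          Real.exp (-(c.κ * torusTreeLen x.1)))
    {θ : ℝ} (hθ0 : 0 ≤ θ) (hθ1 : θ < 1)
    (hC : K * K₀ 64 8 * (2 * (6 * (L : ℝ)) ^ 4) * Real.exp 1 * Real.exp ((1 / 8) * c.κ₁ * (12 ^ 4 - 1)) +
        2 * (64 * K') * K₀ 64 8 * 1344 ≤
      (1 - θ) * (c.E₀ * c.ε₁ * c.C₁ * c.M ^ c.q * Real.exp (c.C₂ * c.κ₁)))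
    -- (2) LEMMA 2 (pp. 10–11): V″_k = V′_k + the local pieces G of P^{(k)}, analytic and (1.36)-small at prefactor θ
    (Gl : TDom 4 (L * N') → Wt.Φ → ℂ) (hVpp : ∀ Y, Wt.Vpp Y = fun φ => Wt.Vp Y φ + Gl Y φ)
    (hGlAn : ∀ Y, Wt.Analytic (Gl Y) (Wt.sp1 Y))
    (hGl : ∀ Y φ, φ ∈ Wt.sp1 Y → ‖Gl Y φ‖ ≤ θ * (c.E₀ * c.ε₁ * c.C₁ * c.M ^ c.q * Real.exp (c.C₂ * c.κ₁)) *
      Real.exp (-((1 - 2 * c.δ) * c.κ * (tsys 4 (L * N')).dj Y)))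
    -- (2) LEMMA 2: the located per-term data of `B13Lemma2Torus.lemma2Printed_twoTorus'`
    {E : Type*} [NormedAddCommGroup E] [NormedSpace ℂ E]
    (rd : TDom 4 (L * N') → Wt.Φ → E) (e : TDom 4 (L * N') → Wt.Bond → E) (he : ∀ Y b, ‖e Y b‖ ≤ 1)
    (hrd : ∀ Y φ, rd Y φ = haveI := Wt.finBond; ∑ b, Wt.Bv φ b • e Y b)
    {ι₂ : Type*} (s : TDom 4 (L * N') → Finset ι₂) (Wf : TDom 4 (L * N') → ι₂ → Wt.Φ → E → ℂ) {g : ℂ} (hg : g ≠ 0)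
    {R K₂ : ℝ} {m₂ : ℕ} (hK₂ : 0 ≤ K₂) (hR : 0 < R) (h3 : 3 * c.ε₁ ≤ R)
    (hW : ∀ Y, ∀ i ∈ s Y, ∀ φ ∈ Wt.sp1 Y, AnalyticOnNhd ℂ (Wf Y i φ) (ball 0 R))
    (hKW : ∀ Y, ∀ i ∈ s Y, ∀ φ ∈ Wt.sp1 Y, ∀ z ∈ ball (0 : E) R,
      ‖Wf Y i φ z‖ ≤ K₂ * Real.exp (-(c.κ₁ - 1) * ((Y.1.card : ℝ) - 1)) * ‖z‖ ^ 3)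
    (hcard : ∀ Y, (s Y).card ≤ m₂ * Y.1.card)
    (hV : ∀ Y, Wt.V Y = fun φ => (∑ i ∈ s Y, scaled g (Wf Y i φ) (rd Y φ)) + Wt.Vpp Y φ)
    (hQ : ∀ Y φ (b b' : Wt.Bond), φ ∈ Wt.sp1 Y →
      Wt.Q Y φ b b' = 2 * ∑ i ∈ s Y, Qop (scaled g (Wf Y i φ)) (rd Y φ) (e Y b) (e Y b'))
    (hsp : ∀ Y φ, φ ∈ Wt.sp1 Y → ‖g‖ * ‖rd Y φ‖ < c.ε₁)
    (hvolk : ∀ Y, Wt.volk Y = Y.1.card)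
    (hfloor : 27 * m₂ * K₂ * Real.exp (c.κ₁ - 1) ≤ c.C₃ * c.M ^ 4 * Real.exp (c.C₂ * c.κ₁))
    (hAnP : ∀ Y, ∀ i ∈ s Y, Wt.Analytic (fun φ => scaled g (Wf Y i φ) (rd Y φ)) (Wt.sp1 Y))
    (hG : ∀ Y, Wt.GaugeInv (Wt.V Y) ∧ Wt.GaugeInv (Wt.toStepData.quadForm Y) ∧ Wt.GaugeInv (Wt.Vpp Y))
    -- (3) LEMMA 3 (pp. 14–20): the signs of (2.18)–(2.20), R12, |τ(Y)| ≥ 2, and the numerics bundle at ℓ = ½L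
    (M₃ : ℕ) [NeZero M₃] {a a₂ a₂' a₅ Aabs : ℝ} (hN : Lemma3Numerics c M₃ ((c.L : ℝ) / 2) a a₂ a₂' a₅ Aabs)
    (h12 : R12 c) (hE : 0 < c.E₀) (hε : 0 < c.ε₁) (hC₁ : 0 < c.C₁) (hα : 0 < c.α₄) (hM : 1 ≤ c.M)
    (hτ2 : c.E₀ * c.ε₁ * c.C₁ * c.α₄⁻¹ * c.M ^ c.q * Real.exp (c.C₂ * c.κ₁) ≤ 1 / 2)
    -- (3) the Cauchy radius and the parameter domains (p. 15)
    {Uσ Uτ : Set ℂ} (hUσ : IsOpen Uσ) (hUτ : IsOpen Uτ) (hUexp : Metric.closedBall (0 : ℂ) (Real.exp c.κ₁) ⊆ Uσ)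
    (hUtau : ∀ Y : TDom 4 (L * N'), Metric.closedBall (0 : ℂ) ((invTau c ((tsys 4 (L * N')).dj Y))⁻¹) ⊆ Uτ)
    {r : ℝ} (hr : 0 < r) (hr' : r ≤ Real.exp c.κ₁ - 1)
    (hsubτ : ∀ x ∈ Set.uIcc (0 : ℝ) 1, Metric.closedBall (x : ℂ) r ⊆ Uτ)
    -- (3) per term (𝐃, P) of every Z ∈ 𝐃_{k+1}: index types, parameter lists, kernels, characteristic functions, potentials
    (Λ C₀ : TDom 4 N' → Finset (TDom 4 (L * N')) × Finset (TBond 4 M₃ (L * N')) → Type)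
    [∀ Z t, Fintype (Λ Z t)] [∀ Z t, DecidableEq (Λ Z t)] [∀ Z t, Fintype (C₀ Z t)] [∀ Z t, DecidableEq (C₀ Z t)]
    (lZ : TDom 4 N' → Finset (TDom 4 (L * N')) × Finset (TBond 4 M₃ (L * N')) → List (TPt 4 N'))
    (hlZ : ∀ Z, ∀ t ∈ terms L M₃ Z, (lZ Z t).Nodup ∧ (lZ Z t).toFinset = Z.1 \ tclosure L N' (Z0 M₃ t))
    (lD : TDom 4 N' → Finset (TDom 4 (L * N')) × Finset (TBond 4 M₃ (L * N')) → List (TDom 4 (L * N')))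
    (hlD : ∀ Z, ∀ t ∈ terms L M₃ Z, (lD Z t).Nodup ∧ (lD Z t).toFinset = t.1)
    (Am : (Z : TDom 4 N') → (t : Finset (TDom 4 (L * N')) × Finset (TBond 4 M₃ (L * N'))) → Wt.Φ →
      (TPt 4 N' → ℂ) → Matrix (Λ Z t) (Λ Z t) ℂ)
    (Γm : (Z : TDom 4 N') → (t : Finset (TDom 4 (L * N')) × Finset (TBond 4 M₃ (L * N'))) → Wt.Φ →
      (TPt 4 N' → ℂ) → (Λ Z t ⊕ C₀ Z t → ℝ) → (Λ Z t → ℂ))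
    (χY₀ χcP : (Z : TDom 4 N') → (t : Finset (TDom 4 (L * N')) × Finset (TBond 4 M₃ (L * N'))) → (Λ Z t → ℝ) → ℝ)
    (hχ0 : ∀ Z t B, 0 ≤ χY₀ Z t B) (hχ1 : ∀ Z t B, χY₀ Z t B ≤ 1)
    (Pl : (Z : TDom 4 N') → (t : Finset (TDom 4 (L * N')) × Finset (TBond 4 M₃ (L * N'))) → Finset (Λ Z t))
    (hPcard : ∀ Z, ∀ t ∈ terms L M₃ Z, (Pl Z t).card = t.2.card) {rP : ℝ} (hrP : 0 ≤ rP)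
    (hχc : ∀ Z t B, χcP Z t B = ∏ b ∈ Pl Z t, (if rP ≤ |B b| then (1 : ℝ) else 0))
    (Dfam : TDom 4 N' → Finset (TDom 4 (L * N')) × Finset (TBond 4 M₃ (L * N')) → Finset (TDom 4 (L * N')))
    (Vr : (Z : TDom 4 N') → (t : Finset (TDom 4 (L * N')) × Finset (TBond 4 M₃ (L * N'))) → Wt.Φ →
      TDom 4 (L * N') → (Λ Z t → ℝ) → ℂ)
    -- (3) termwise domination: ‖H(Z)‖ ≤ Σ_{(𝐃,P)} ‖(2.14)‖ on the space of p. 15 ((2.9)/(2.14))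
    (hH : ∀ (Z : TDom 4 N') (φ : Wt.Φ), φ ∈ Wt.sp2 Z → ‖Wt.H Z φ‖ ≤
      ∑ t ∈ terms L M₃ Z, ‖term214 r (lZ Z t) (lD Z t)
        (core214 (Am Z t φ) (Γm Z t φ) (F214 t.2.card (χY₀ Z t) (χcP Z t) (Dfam Z t) (Vr Z t φ))) 0 0‖)
    -- (3) the record's objects behind the terms: bonds, cubes, the real field inside the configurations
    (ιb : (Z : TDom 4 N') → (t : Finset (TDom 4 (L * N')) × Finset (TBond 4 M₃ (L * N'))) → Λ Z t → Wt.Bond)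
    (hι : ∀ Z t, Function.Injective (ιb Z t)) (cube : Wt.Bond → TPt 4 (L * N'))
    (hQsupp : ∀ (Y : TDom 4 (L * N')) φ b b', Wt.Q Y φ b b' ≠ 0 → cube b ∈ Y.1 ∧ cube b' ∈ Y.1)
    {m' : ℕ} (hfibc : ∀ Z t (x : TPt 4 (L * N')), (Finset.univ.filter fun j => cube (ιb Z t j) = x).card ≤ m')
    (emb : (Z : TDom 4 N') → (t : Finset (TDom 4 (L * N')) × Finset (TBond 4 M₃ (L * N'))) → Wt.Φ →
      (Λ Z t → ℝ) → Wt.Φ)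
    (hBv : ∀ Z t φ B b, Wt.Bv (emb Z t φ B) (ιb Z t b) = (B b : ℂ))
    (hBv0 : ∀ Z t φ B b', b' ∉ Set.range (ιb Z t) → Wt.Bv (emb Z t φ B) b' = 0)
    (hVr : ∀ Z, ∀ t ∈ terms L M₃ Z, ∀ φ ∈ Wt.sp2 Z, ∀ Y ∈ Dfam Z t, ∀ B,
      emb Z t φ B ∈ Wt.sp1 Y → Vr Z t φ Y B = Wt.V Y (emb Z t φ B))
    (hχsupp : ∀ Z, ∀ t ∈ terms L M₃ Z, ∀ φ ∈ Wt.sp2 Z, ∀ B, χY₀ Z t B ≠ 0 → ∀ Y ∈ Dfam Z t,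
      emb Z t φ B ∈ Wt.sp1 Y)
    -- (3) separate holomorphy of the X-integral in (σ, τ)
    (hΨσ : ∀ Z, ∀ t ∈ terms L M₃ Z, ∀ φ ∈ Wt.sp2 Z, ∀ τ : TDom 4 (L * N') → ℂ, (∀ j, τ j ∈ Uτ) →
      SepHolOn Uσ (fun σ => core214 (Am Z t φ) (Γm Z t φ)
        (F214 t.2.card (χY₀ Z t) (χcP Z t) (Dfam Z t) (Vr Z t φ)) σ τ))
    (hΨτ : ∀ Z, ∀ t ∈ terms L M₃ Z, ∀ φ ∈ Wt.sp2 Z, ∀ σ : TPt 4 N' → ℂ, (∀ j, σ j ∈ Uσ) →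
      SepHolOn Uτ (fun τ => core214 (Am Z t φ) (Γm Z t φ)
        (F214 t.2.card (χY₀ Z t) (χcP Z t) (Dfam Z t) (Vr Z t φ)) σ τ))
    -- (3) the reference covariance, Γ₀, the kernels of Γ(σ)
    (Cm : (Z : TDom 4 N') → (t : Finset (TDom 4 (L * N')) × Finset (TBond 4 M₃ (L * N'))) → Wt.Φ →
      Matrix (Λ Z t) (Λ Z t) ℝ)
    (Γ₀m : (Z : TDom 4 N') → (t : Finset (TDom 4 (L * N')) × Finset (TBond 4 M₃ (L * N'))) → Wt.Φ →
      Matrix (Λ Z t) (Λ Z t ⊕ C₀ Z t) ℝ)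
    (Gm : (Z : TDom 4 N') → (t : Finset (TDom 4 (L * N')) × Finset (TBond 4 M₃ (L * N'))) → Wt.Φ →
      (TPt 4 N' → ℂ) → Matrix (Λ Z t) (Λ Z t ⊕ C₀ Z t) ℂ)
    (hAs : ∀ Z, ∀ t ∈ terms L M₃ Z, ∀ φ ∈ Wt.sp2 Z, ∀ σ : TPt 4 N' → ℂ, (∀ j, ‖σ j‖ ≤ Real.exp c.κ₁) →
      (Am Z t φ σ).IsSymm)
    (hA : ∀ Z, ∀ t ∈ terms L M₃ Z, ∀ φ ∈ Wt.sp2 Z, ∀ σ : TPt 4 N' → ℂ, (∀ j, ‖σ j‖ ≤ Real.exp c.κ₁) →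
      ((Am Z t φ σ).map Complex.re).PosDef)
    (hlin : ∀ Z, ∀ t ∈ terms L M₃ Z, ∀ φ ∈ Wt.sp2 Z, ∀ σ : TPt 4 N' → ℂ, (∀ j, ‖σ j‖ ≤ Real.exp c.κ₁) →
      ∀ X : Λ Z t ⊕ C₀ Z t → ℝ, Γm Z t φ σ X = Gm Z t φ σ *ᵥ fun j => (X j : ℂ))
    {γ₂ : ℝ} (hγ₂ : 0 ≤ γ₂)
    -- (3) the bonds located on a site torus (for the kernel letters)
    {ν : ℕ} {Nf : Fin ν → ℕ} [∀ i, NeZero (Nf i)]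
    (locΛ : (Z : TDom 4 N') → (t : Finset (TDom 4 (L * N')) × Finset (TBond 4 M₃ (L * N'))) → Λ Z t → UT Nf)
    (locN : (Z : TDom 4 N') → (t : Finset (TDom 4 (L * N')) × Finset (TBond 4 M₃ (L * N'))) →
      Λ Z t ⊕ C₀ Z t → UT Nf) {m : ℕ}
    (hfibΛ : ∀ Z t (x : UT Nf), (Finset.univ.filter fun i => locΛ Z t i = x).card ≤ m)
    (hfibN : ∀ Z t (x : UT Nf), (Finset.univ.filter fun j => locN Z t j = x).card ≤ m)
    -- (3) rates and constants
    {kap kap' kap'' ϑ θE θΓ θC KG KΓ KCs K₀' : ℝ} (hkap'' : 0 < kap'') (hk1 : kap'' < kap') (hk2 : kap' < kap)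
    (hθE : 0 ≤ θE) (hθΓ : 0 ≤ θΓ) (hθC : 0 ≤ θC) (hKG : 0 ≤ KG) (hKΓ : 0 ≤ KΓ) (hKCs : 0 ≤ KCs) (hK₀' : 0 ≤ K₀')
    (hθEle : θE ≤ ϑ) (hθΓle : θΓ ≤ ϑ)
    (hθR1le : (m * (1 + 2 / (kap - kap')) ^ ν) * (m * (1 + 2 / (kap' - kap'')) ^ ν)
      * (θΓ * KCs * KG + KΓ * θC * KG + KΓ * K₀' * θΓ) ≤ ϑ)
    -- (3) NODE O's two NAMED (2.16)-level records per term (𝐃, P) and configuration: L17a and L16a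
    (h17 : ∀ Z, ∀ t ∈ terms L M₃ Z, ∀ φ ∈ Wt.sp2 Z,
      Localisation17a c (Am Z t φ) (Gm Z t φ) (Γ₀m Z t φ) (Cm Z t φ) (locΛ Z t) (locN Z t) kap KG KΓ KCs K₀')
    (h16 : ∀ Z, ∀ t ∈ terms L M₃ Z, ∀ φ ∈ Wt.sp2 Z,
      Differences216 c (Am Z t φ) (Gm Z t φ) (Γ₀m Z t φ) (Cm Z t φ) (locΛ Z t) (locN Z t) kap θΓ θC θE)
    (hsmallKθ : K₀' * (m * (1 + 2 / kap) ^ ν) * (ϑ * (m * (1 + 2 / kap'') ^ ν)) < 1)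
    -- (3) the (2.24)–(2.25) smallness with `a₂₀ = m′·α₄·M⁻⁴(1 + 32/(κ₁−1))⁴`, norms of C and Γ₀
    {cE gq : ℝ} (hc0 : 0 ≤ cE)
    (hCq : ∀ Z, ∀ t ∈ terms L M₃ Z, ∀ φ ∈ Wt.sp2 Z, ∃ hC : (Cm Z t φ).PosDef, ∀ i, hC.1.eigenvalues i ≤ cE)
    (hαc : (2 * (ϑ * (m * (1 + 2 / kap'') ^ ν)) +
      (γ₂ + m' * c.α₄ * (c.M ^ 4)⁻¹ * (1 + 32 / (c.κ₁ - 1)) ^ 4)) * cE ≤ 1 / 2) (hgq : 0 ≤ gq)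
    (hΓq : ∀ Z, ∀ t ∈ terms L M₃ Z, ∀ φ ∈ Wt.sp2 Z, ∀ X : Λ Z t ⊕ C₀ Z t → ℝ,
      (Γ₀m Z t φ *ᵥ X) ⬝ᵥ (Cm Z t φ *ᵥ (Γ₀m Z t φ *ᵥ X)) ≤ gq * (X ⬝ᵥ X))
    (hsmall : (2 * (ϑ * (m * (1 + 2 / kap'') ^ ν)) +
      (γ₂ + m' * c.α₄ * (c.M ^ 4)⁻¹ * (1 + 32 / (c.κ₁ - 1)) ^ 4)) * (1 + 2 * cE * gq) ≤ 1 / 2)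
    -- (3) constant matching, p. 17: `a ≤ γ₂ r_P²` and the volume factor with `w = K₀(64,8)·α₄·#(⋃𝐃)`
    (hPa : a ≤ γ₂ * rP ^ 2)
    (hvol : ∀ Z, ∀ t ∈ terms L M₃ Z,
      2 * (K₀' * (m * (1 + 2 / kap) ^ ν) * (ϑ * (m * (1 + 2 / kap'') ^ ν))
              * (1 + (1 - K₀' * (m * (1 + 2 / kap) ^ ν) * (ϑ * (m * (1 + 2 / kap'') ^ ν)))⁻¹) / 2)
          * (Fintype.card (Λ Z t) : ℝ)
        + K₀ 64 8 * c.α₄ * ((((Dfam Z t).image Subtype.val).biUnion id).card : ℝ)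
        + (2 * (ϑ * (m * (1 + 2 / kap'') ^ ν)) +
            (γ₂ + m' * c.α₄ * (c.M ^ 4)⁻¹ * (1 + 32 / (c.κ₁ - 1)) ^ 4)) * cE * (Fintype.card (Λ Z t) : ℝ)
        + (2 * (ϑ * (m * (1 + 2 / kap'') ^ ν)) +
            (γ₂ + m' * c.α₄ * (c.M ^ 4)⁻¹ * (1 + 32 / (c.κ₁ - 1)) ^ 4)) * (1 + 2 * cE * gq)
            * (Fintype.card (Λ Z t ⊕ C₀ Z t) : ℝ)
        ≤ a₅ * ((Z.1).card : ℝ)) :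
    B13.Lemma1Printed Wt.toStepData c ∧ B13.Lemma2Printed Wt.toStepData c ∧ B13.Lemma3Printed Wt.toStepData c :=
  b13Leaf_twoTorus_primitives Wt c k hN12 hL8 hLc S0 F Sq SX T Sc Sq' SX' T' dist h133 hS0Y hFsub hSq hScY hdist0
    hdist hSX hSX' hX0 hAdd hZero hAnT hAnT' hK hK' hκ hδ1 hδκ hκ126 hκ126' hκ₁ hκ₁' hδ₀M hδ₀M5 hR8 hR9 h124 h130
    hθ0 hθ1 hC Gl hVpp hGlAn hGl rd e he hrd s Wf hg hK₂ hR h3 hW hKW hcard hV hQ hsp hvolk hfloor hAnP hG M₃ hN h12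
    hE hε hC₁ hα hM hτ2 hUσ hUτ hUexp hUtau hr hr' hsubτ Λ C₀ lZ hlZ lD hlD Am Γm χY₀ χcP hχ0 hχ1 Pl hPcard hrP hχc
    Dfam Vr hH ιb hι cube hQsupp hfibc emb hBv hBv0 hVr hχsupp hΨσ hΨτ Cm Γ₀m Gm hAs hA hlin hγ₂ locΛ locN hfibΛ
    hfibN hkap'' hk1 hk2 hθE hθΓ hθC hKG hKΓ hKCs hK₀' hθEle hθΓle hθR1le (fun Z t ht φ hφ => (h17 Z t ht φ hφ).hG)
    (fun Z t ht φ hφ => (h17 Z t ht φ hφ).hΓ₀) (fun Z t ht φ hφ => (h17 Z t ht φ hφ).hCs)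
    (fun Z t ht φ hφ => (h17 Z t ht φ hφ).hC216) (fun Z t ht φ hφ => (h16 Z t ht φ hφ).hdΓ)
    (fun Z t ht φ hφ => (h16 Z t ht φ hφ).hdC) (fun Z t ht φ hφ => (h16 Z t ht φ hφ).hdE) hsmallKθ hc0 hCq hαc hgq
    hΓq hsmall hPa hvol

end Kernel216

end Literature.MathematicalPhysics.QuantumFieldTheory.Balaban1983to89.B13NodeTorusKernel216

end
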